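import Summits.ResolutionOfSingularities.ResolutionOfSingularities.Theorems.PurelyInseparableDim4Target
import Summits.ResolutionOfSingularities.ResolutionOfSingularities.Theorems.PurelyInseparableDim4Rules
import Literature.AlgebraicGeometry.Resolution.CentreBlowupOrdAlongBasics
import Mathlib.SetTheory.Ordinal.Family
import HarnessLib
import HarnessLib.Audit.Tags

/-!
# Purely inseparable fourfolds `z^p + F(x₁,…,x₄)` — DETERMINACY and POSITIONALITY of the centre game
# [OURS · counted 0 · a statement about OUR frame (`PurelyInseparableDim4Rules`), not about resolution]

Census cell «res-dim4-pi» (D-0157 DOOR 2), width seat `res-dim4-p-14`, brick PR-12.  The Rules add-on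
(`PurelyInseparableDim4Rules`) types OUR QUESTION `TerminatesSomeRule p q` — "over every field of
characteristic `p` SOME permissible coordinate-centre rule `R : State K → Finset (Fin 4)` has no infinite
branch" — together with its kill-certificate shape `IsTrap` and the one-way lemma
`not_terminatesSomeRule_of_trap` (a nonempty trap defeats every rule).  This file proves the CONVERSE and
the game-theoretic bookkeeping behind it, once and for all, for an ABSTRACT reachability game
(positions `P`, moves `M`, legality `legal : P → M → Prop`, answers `succ : P → M → P → Prop`; player A
must move while a legal move exists, player B answers; A wins a play when it stops):

* `Game.Wins` — A's ATTRACTOR: the least predicate containing the positions without legal move and closed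
  under «some legal move all of whose answers win» (= "A has a winning strategy from here", history
  allowed);
* `Game.wins_of_isWinningPositional` / **`Game.exists_isWinningPositional_of_forall_wins`** — a POSITIONAL
  strategy winning from every position exists iff every position is in the attractor.  The strategy is
  read off the attractor RANK (`Game.RankLE`, `Game.rank`, ORDINAL-valued: at the state level player B has
  infinitely many answers `b ∈ K⁴`, so ranks beyond `ω` occur); hence "positional" costs nothing — any
  winning strategy, history-dependent or not, yields a positional one [folklore: positional determinacy
  of reachability games, e.g. Grädel–Thomas–Wilke, LNCS 2500 (2002), Ch. 2];
* `Game.isTrapSet_setOf_not_wins`, `Game.Wins.not_mem_of_isTrapSet` — the complement of the attractor is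
  the LARGEST TRAP, so «no nonempty trap» ⟺ «A wins everywhere» ⟺ «a positional winning strategy exists»
  (`Game.forall_wins_iff_not_exists_trap`, `Game.forall_wins_iff_exists_isWinningPositional`).

Instantiated on the frame (positions = presented states `State K`, moves = coordinate centres
`S : Finset (Fin 4)`, legal = `IsPermissibleCentre q S s.F`, answers = `Edge q S s s'`):

* `StateWins q s` — the ESCAPABLE states (A's attractor); `isTrap_setOf_not_stateWins` — the
  non-escapable states form a trap (the largest one); `isTrap_iff_isTrapSet`;
* **`terminatesSomeRule_iff_forall_stateWins`**: `TerminatesSomeRule p q ↔` every state over every field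
  of characteristic `p` is escapable;
* **`not_terminatesSomeRule_iff_exists_trap`**: `¬ TerminatesSomeRule p q ↔` some field of characteristic
  `p` carries a nonempty `IsTrap` set — the kill-certificate shape of the Rules file is COMPLETE (the
  census' TRAP / ESCAPABLE classification of recurrence states is exactly the dichotomy
  `¬ StateWins / StateWins`);
* `exists_rule_of_forall_stateWins` (+ an ordinal-valued `SecondaryInvariantUnder` for that rule,
  `exists_rule_secondaryInvariantUnder_of_forall_stateWins`), `stateWins_of_terminatesUnder`.

Nothing here asserts that any state is or is not escapable; `TerminatesSomeRule 2 2` is refuted in the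
tree (`PurelyInseparableDim4CoordinateTrap`).  Nothing here proves resolution of singularities in
dimension ≥ 4 / characteristic `p`; counted 0; AI work, weaker than expert review.
bears_on: LADDER-RESOLUTION:D157-DOOR2 (res-dim4-pi · PR-12). Supports stmt-ResolutionOfSingularities-16155
(helper).
-/

set_option linter.dupNamespace false

namespace Summit.ResolutionOfSingularities.ResolutionOfSingularities.Theorems.PIDim4

/-! ## 1. Abstract reachability games: attractor, positional strategies, traps -/

namespace Game

variable {P M : Type} (legal : P → M → Prop) (succ : P → M → P → Prop)

/-- **A's attractor** (winning positions): a position with no legal move is won (the play has stopped);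
a position with SOME legal move ALL of whose answers are won is won. [folklore] -/
inductive Wins : P → Prop
  | terminal {x : P} (h : ∀ m, ¬ legal x m) : Wins x
  | move {x : P} {m : M} (hm : legal x m) (h : ∀ y, succ x m y → Wins y) : Wins x

/-- A **positional strategy** `σ : P → M` **winning from every position**: it moves legally whenever a
legal move exists, and no infinite play follows it. [folklore] -/
def IsWinningPositional (σ : P → M) : Prop :=
  (∀ x, (∃ m, legal x m) → legal x (σ x)) ∧
    ¬ ∃ c : ℕ → P, ∀ k, legal (c k) (σ (c k)) ∧ succ (c k) (σ (c k)) (c (k + 1))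

/-- A **trap**: a set of positions, each with a legal move, in which every legal move has an answer
staying in the set (player B's winning certificate). [folklore] -/
def IsTrapSet (T : Set P) : Prop :=
  ∀ x ∈ T, (∃ m, legal x m) ∧ ∀ m, legal x m → ∃ y ∈ T, succ x m y

/-- A won position lies in no trap. [folklore] -/
theorem Wins.not_mem_of_isTrapSet {T : Set P} (hT : IsTrapSet legal succ T) {x : P}
    (hx : Wins legal succ x) : x ∉ T := by
  induction hx with
  | terminal h =>
    intro hxT
    obtain ⟨⟨m, hm⟩, -⟩ := hT _ hxT
    exact h m hm
  | move hm _ ih =>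
    intro hxT
    obtain ⟨-, hall⟩ := hT _ hxT
    obtain ⟨y, hyT, hy⟩ := hall _ hm
    exact ih y hy hyT

/-- The complement of the attractor is a trap (the largest one). [folklore] -/
theorem isTrapSet_setOf_not_wins : IsTrapSet legal succ {x | ¬ Wins legal succ x} := by
  intro x hx
  refine ⟨?_, fun m hm => ?_⟩
  · by_contra h
    exact hx (Wins.terminal fun m hm => h ⟨m, hm⟩)
  · by_contra h
    exact hx (Wins.move hm fun y hy => Classical.by_contradiction fun hyW => h ⟨y, hyW, hy⟩)

/-- Some position is lost for A iff a nonempty trap exists. [folklore] -/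
theorem exists_not_wins_iff_exists_trap :
    (∃ x, ¬ Wins legal succ x) ↔ ∃ T : Set P, T.Nonempty ∧ IsTrapSet legal succ T :=
  ⟨fun ⟨x, hx⟩ => ⟨{x | ¬ Wins legal succ x}, ⟨x, hx⟩, isTrapSet_setOf_not_wins legal succ⟩,
    fun ⟨_, ⟨x, hxT⟩, hT⟩ => ⟨x, fun hx => hx.not_mem_of_isTrapSet legal succ hT hxT⟩⟩

/-- A wins everywhere iff there is no nonempty trap. [folklore] -/
theorem forall_wins_iff_not_exists_trap :
    (∀ x, Wins legal succ x) ↔ ¬ ∃ T : Set P, T.Nonempty ∧ IsTrapSet legal succ T := by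
  rw [← exists_not_wins_iff_exists_trap, not_exists]
  exact forall_congr' fun _ => (not_not).symm

/-- A positional strategy winning from everywhere puts every position in the attractor (player B could
otherwise stay in the complement trap for ever). [folklore] -/
theorem wins_of_isWinningPositional {σ : P → M} (hσ : IsWinningPositional legal succ σ) (x : P) :
    Wins legal succ x := by
  by_contra hx
  apply hσ.2
  have key : ∀ y : {y // ¬ Wins legal succ y}, ∃ z : {z // ¬ Wins legal succ z},
      legal y.1 (σ y.1) ∧ succ y.1 (σ y.1) z.1 := by
    rintro ⟨y, hy⟩
    obtain ⟨hleg, hall⟩ := isTrapSet_setOf_not_wins legal succ y hy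
    obtain ⟨z, hz, hyz⟩ := hall _ (hσ.1 y hleg)
    exact ⟨⟨z, hz⟩, hσ.1 y hleg, hyz⟩
  choose f hf using key
  refine ⟨fun k => (f^[k] ⟨x, hx⟩).1, fun k => ?_⟩
  show legal (f^[k] ⟨x, hx⟩).1 (σ (f^[k] ⟨x, hx⟩).1) ∧ succ (f^[k] ⟨x, hx⟩).1 (σ (f^[k] ⟨x, hx⟩).1) (f^[k + 1] ⟨x, hx⟩).1
  rw [Function.iterate_succ_apply']
  exact hf _

/-! ### The attractor rank (ordinal-valued) and the positional strategy it defines -/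

/-- **Rank bound**: `RankLE α x` — A wins from `x` within "height `≤ α`": no legal move, or some legal move
all of whose answers have a rank bound `< α`. [folklore] -/
inductive RankLE : Ordinal.{0} → P → Prop
  | terminal {α : Ordinal.{0}} {x : P} (h : ∀ m, ¬ legal x m) : RankLE α x
  | move {α : Ordinal.{0}} {x : P} {m : M} (ρ : P → Ordinal.{0}) (hm : legal x m)
      (hlt : ∀ y, succ x m y → ρ y < α) (h : ∀ y, succ x m y → RankLE (ρ y) y) : RankLE α x

/-- Rank bounds are upward closed. [folklore] -/
theorem RankLE.mono {α β : Ordinal.{0}} {x : P} (h : RankLE legal succ α x) (hαβ : α ≤ β) :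
    RankLE legal succ β x := by
  cases h with
  | terminal h => exact RankLE.terminal h
  | move ρ hm hlt h => exact RankLE.move ρ hm (fun y hy => lt_of_lt_of_le (hlt y hy) hαβ) h

/-- A rank bound puts the position in the attractor. [folklore] -/
theorem RankLE.wins {α : Ordinal.{0}} {x : P} (h : RankLE legal succ α x) : Wins legal succ x := by
  induction h with
  | terminal h => exact Wins.terminal h
  | move ρ hm _ _ ih => exact Wins.move hm ih

/-- Every position of the attractor has a rank bound (the successor of the supremum of bounds of the
answers to a winning move; a supremum over a `Type`-indexed family of ordinals exists). [folklore] -/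
theorem Wins.exists_rankLE {x : P} (h : Wins legal succ x) : ∃ α, RankLE legal succ α x := by
  induction h with
  | terminal h => exact ⟨0, RankLE.terminal h⟩
  | @move x m hm _ ih =>
    classical
    let ρ : P → Ordinal.{0} := fun y => if hy : succ x m y then (ih y hy).choose else 0
    have hρ : ∀ y, succ x m y → RankLE legal succ (ρ y) y := fun y hy => by
      simp only [ρ, dif_pos hy]
      exact (ih y hy).choose_spec
    refine ⟨Order.succ (⨆ y : P, ρ y), RankLE.move ρ hm (fun y _ => ?_) hρ⟩
    rw [Order.lt_succ_iff]
    exact Ordinal.le_iSup ρ y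

/-- **The attractor rank**: the least rank bound (and `0` off the attractor, by `sInf ∅ = 0`).
[folklore] -/
noncomputable def rank (x : P) : Ordinal.{0} :=
  sInf {α | RankLE legal succ α x}

/-- The rank of a position of the attractor is a rank bound. [folklore] -/
theorem rankLE_rank {x : P} (h : ∃ α, RankLE legal succ α x) : RankLE legal succ (rank legal succ x) x :=
  csInf_mem (s := {α | RankLE legal succ α x}) h

/-- The rank is the least rank bound. [folklore] -/
theorem rank_le {x : P} {α : Ordinal.{0}} (h : RankLE legal succ α x) : rank legal succ x ≤ α :=
  csInf_le' (s := {α | RankLE legal succ α x}) h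

/-- At a position of the attractor that still has a legal move, some legal move strictly lowers the
rank at every answer. [folklore] -/
theorem exists_move_rank_lt {x : P} (hx : Wins legal succ x) (hleg : ∃ m, legal x m) :
    ∃ m, legal x m ∧ ∀ y, succ x m y → rank legal succ y < rank legal succ x := by
  have hr := rankLE_rank legal succ hx.exists_rankLE
  cases hr with
  | terminal h =>
    obtain ⟨m, hm⟩ := hleg
    exact absurd hm (h m)
  | move ρ hm hlt h =>
    exact ⟨_, hm, fun y hy => lt_of_le_of_lt (rank_le legal succ (h y hy)) (hlt y hy)⟩

/-- **Positional determinacy (A's side).** If every position is in the attractor, the rank-lowering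
choice is a positional strategy winning from every position: ordinals admit no infinite descent.
[folklore: Grädel–Thomas–Wilke, LNCS 2500, Ch. 2 (memoryless strategies in reachability games)] -/
theorem exists_isWinningPositional_of_forall_wins [Inhabited M] (hW : ∀ x, Wins legal succ x) :
    ∃ σ : P → M, IsWinningPositional legal succ σ := by
  classical
  let good : P → M → Prop := fun x m =>
    legal x m ∧ ∀ y, succ x m y → rank legal succ y < rank legal succ x
  let σ : P → M := fun x => if h : ∃ m, good x m then h.choose else default
  have hσ : ∀ x, (∃ m, legal x m) → good x (σ x) := fun x hleg => by
    have h : ∃ m, good x m := exists_move_rank_lt legal succ (hW x) hleg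
    simp only [σ, dif_pos h]
    exact h.choose_spec
  refine ⟨σ, fun x hleg => (hσ x hleg).1, ?_⟩
  rintro ⟨c, hc⟩
  have hdec : ∀ k, rank legal succ (c (k + 1)) < rank legal succ (c k) := fun k =>
    (hσ (c k) ⟨_, (hc k).1⟩).2 _ (hc k).2
  obtain ⟨_, ⟨k, rfl⟩, hmin⟩ :=
    wellFounded_lt.has_min (Set.range fun k => rank legal succ (c k)) ⟨_, 0, rfl⟩
  exact hmin _ ⟨k + 1, rfl⟩ (hdec k)

/-- The rank is an ordinal-valued quantity strictly decreasing along every play of the strategy of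
`exists_isWinningPositional_of_forall_wins` (a "secondary invariant" for it). [folklore] -/
theorem exists_isWinningPositional_rank_lt_of_forall_wins [Inhabited M] (hW : ∀ x, Wins legal succ x) :
    ∃ σ : P → M, IsWinningPositional legal succ σ ∧
      ∀ x y, legal x (σ x) → succ x (σ x) y → rank legal succ y < rank legal succ x := by
  classical
  let good : P → M → Prop := fun x m =>
    legal x m ∧ ∀ y, succ x m y → rank legal succ y < rank legal succ x
  let σ : P → M := fun x => if h : ∃ m, good x m then h.choose else default
  have hσ : ∀ x, (∃ m, legal x m) → good x (σ x) := fun x hleg => by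
    have h : ∃ m, good x m := exists_move_rank_lt legal succ (hW x) hleg
    simp only [σ, dif_pos h]
    exact h.choose_spec
  have hlt : ∀ x y, legal x (σ x) → succ x (σ x) y → rank legal succ y < rank legal succ x :=
    fun x y hx hy => (hσ x ⟨_, hx⟩).2 y hy
  refine ⟨σ, ⟨fun x hleg => (hσ x hleg).1, ?_⟩, hlt⟩
  rintro ⟨c, hc⟩
  obtain ⟨_, ⟨k, rfl⟩, hmin⟩ :=
    wellFounded_lt.has_min (Set.range fun k => rank legal succ (c k)) ⟨_, 0, rfl⟩
  exact hmin _ ⟨k + 1, rfl⟩ (hlt _ _ (hc k).1 (hc k).2)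

/-- **A wins everywhere iff a positional strategy winning from everywhere exists.** [folklore] -/
theorem forall_wins_iff_exists_isWinningPositional [Inhabited M] :
    (∀ x, Wins legal succ x) ↔ ∃ σ : P → M, IsWinningPositional legal succ σ :=
  ⟨exists_isWinningPositional_of_forall_wins legal succ,
    fun ⟨_, hσ⟩ x => wins_of_isWinningPositional legal succ hσ x⟩

/-- **Determinacy in certificate form**: a positional strategy winning from everywhere exists iff there
is no nonempty trap. [folklore] -/
theorem exists_isWinningPositional_iff_not_exists_trap [Inhabited M] :
    (∃ σ : P → M, IsWinningPositional legal succ σ) ↔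
      ¬ ∃ T : Set P, T.Nonempty ∧ IsTrapSet legal succ T := by
  rw [← forall_wins_iff_exists_isWinningPositional, forall_wins_iff_not_exists_trap]

end Game

/-! ## 2. The coordinate-centre game of the frame -/

section StateGame

open Literature.AlgebraicGeometry.Resolution

variable {K : Type} [Field K] [DecidableEq K] (q : ℕ)

/-- **Escapable state** (A's attractor of the coordinate-centre game at the exponent `q`): no
permissible coordinate centre exists (the origin is no longer `q`-fold), or SOME permissible coordinate
centre has ALL its edges (equimultiple points of its charts, cleaned, non-zero) leading to escapable
states.  The census' ESCAPABLE / TRAP dichotomy. [OURS · frame bookkeeping] [folklore] -/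
def StateWins (s : State K) : Prop :=
  Game.Wins (fun (t : State K) (S : Finset (Fin 4)) => IsPermissibleCentre q S t.F)
    (fun t S t' => Edge q S t t') s

omit [DecidableEq K] in
/-- A permissible coordinate centre exists iff the origin is `q`-fold (`q ≤ ord₀ F`, read as
`ordAlong univ`): the point is then permissible, and `ordAlong S F ≤ ordAlong univ F`. [folklore] -/
theorem exists_isPermissibleCentre_iff (F : MvPolynomial (Fin 4) K) :
    (∃ S, IsPermissibleCentre q S F) ↔ (q : ℕ∞) ≤ CentreBlowup.ordAlong Finset.univ F := by
  constructor
  · rintro ⟨S, -, hS⟩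
    exact le_trans hS (CentreBlowup.ordAlong_mono (Finset.subset_univ S) F)
  · intro h
    exact ⟨Finset.univ, Finset.univ_nonempty, h⟩

/-- A rule is permissible and terminating iff it is a positional strategy winning from every state
(definitional). [folklore] -/
theorem isPermissibleRule_and_terminatesUnder_iff (R : CentreRule K) :
    IsPermissibleRule q R ∧ TerminatesUnder q R ↔
      Game.IsWinningPositional (fun (t : State K) (S : Finset (Fin 4)) => IsPermissibleCentre q S t.F)
        (fun t S t' => Edge q S t t') R :=
  Iff.rfl

/-- The Rules file's `IsTrap` is the abstract trap of the coordinate-centre game. [folklore] -/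
theorem isTrap_iff_isTrapSet (T : Set (State K)) :
    IsTrap q T ↔ Game.IsTrapSet (fun (t : State K) (S : Finset (Fin 4)) => IsPermissibleCentre q S t.F)
      (fun t S t' => Edge q S t t') T := by
  unfold IsTrap Game.IsTrapSet
  simp only [exists_isPermissibleCentre_iff]

/-- The non-escapable states form a trap (the largest one). [folklore] -/
theorem isTrap_setOf_not_stateWins : IsTrap q {s : State K | ¬ StateWins q s} := by
  rw [isTrap_iff_isTrapSet]
  exact Game.isTrapSet_setOf_not_wins _ _

/-- A state in a trap is not escapable. [folklore] -/
theorem not_stateWins_of_mem_isTrap {T : Set (State K)} (hT : IsTrap q T) {s : State K} (hs : s ∈ T) :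
    ¬ StateWins q s := fun h =>
  Game.Wins.not_mem_of_isTrapSet _ _ ((isTrap_iff_isTrapSet q T).mp hT) h hs

/-- Over one field: every state is escapable iff no nonempty trap exists. [folklore] -/
theorem forall_stateWins_iff_not_exists_trap :
    (∀ s : State K, StateWins q s) ↔ ¬ ∃ T : Set (State K), IsTrap q T ∧ T.Nonempty := by
  unfold StateWins
  rw [Game.forall_wins_iff_not_exists_trap]
  simp only [isTrap_iff_isTrapSet, and_comm]

/-- Over one field: a terminating permissible rule makes every state escapable. [folklore] -/
theorem stateWins_of_terminatesUnder {R : CentreRule K} (hR : IsPermissibleRule q R)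
    (hT : TerminatesUnder q R) (s : State K) : StateWins q s :=
  Game.wins_of_isWinningPositional _ _ ((isPermissibleRule_and_terminatesUnder_iff q R).mp ⟨hR, hT⟩) s

/-- Over one field: if every state is escapable, SOME permissible rule terminates — positionality is
free (the rank-lowering rule). [folklore] -/
theorem exists_rule_of_forall_stateWins (h : ∀ s : State K, StateWins q s) :
    ∃ R : CentreRule K, IsPermissibleRule q R ∧ TerminatesUnder q R := by
  obtain ⟨R, hR⟩ := Game.exists_isWinningPositional_of_forall_wins _ _ h
  exact ⟨R, (isPermissibleRule_and_terminatesUnder_iff q R).mpr hR⟩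

/-- … and that rule carries an explicit secondary invariant: the attractor rank (ordinal-valued; typed
as the well-founded pull-back order on `State K`, since `SecondaryInvariantUnder` wants `W : Type`).
[folklore] -/
theorem exists_rule_secondaryInvariantUnder_of_forall_stateWins (h : ∀ s : State K, StateWins q s) :
    ∃ R : CentreRule K, IsPermissibleRule q R ∧ TerminatesUnder q R ∧ SecondaryInvariantUnder q R := by
  obtain ⟨R, hR, hlt⟩ := Game.exists_isWinningPositional_rank_lt_of_forall_wins
    (fun (t : State K) (S : Finset (Fin 4)) => IsPermissibleCentre q S t.F) (fun t S t' => Edge q S t t') h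
  refine ⟨R, ((isPermissibleRule_and_terminatesUnder_iff q R).mpr hR).1,
    ((isPermissibleRule_and_terminatesUnder_iff q R).mpr hR).2, ?_⟩
  -- `W := State K` ordered by the attractor rank (an ordinal-valued height pulled back to states)
  exact ⟨State K, InvImage (· < ·) (Game.rank
      (fun (t : State K) (S : Finset (Fin 4)) => IsPermissibleCentre q S t.F) (fun t S t' => Edge q S t t')),
    InvImage.wf _ wellFounded_lt, id, fun s s' hss' => hlt s s' hss'.1 hss'.2⟩

/-- Over one field: «some permissible rule terminates» iff «every state is escapable». [folklore] -/
theorem exists_rule_iff_forall_stateWins :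
    (∃ R : CentreRule K, IsPermissibleRule q R ∧ TerminatesUnder q R) ↔ ∀ s : State K, StateWins q s :=
  ⟨fun ⟨_, hR, hT⟩ => stateWins_of_terminatesUnder q hR hT, exists_rule_of_forall_stateWins q⟩

end StateGame

/-! ## 3. `TerminatesSomeRule`: the trap certificate is complete -/

/-- **`TerminatesSomeRule p q` ⟺ every presented state over every field of characteristic `p` is
escapable.** [OURS · frame bookkeeping] [folklore] -/
theorem terminatesSomeRule_iff_forall_stateWins (p q : ℕ) :
    TerminatesSomeRule p q ↔
      ∀ (K : Type) [Field K] [CharP K p] [DecidableEq K], ∀ s : State K, StateWins q s := by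
  unfold TerminatesSomeRule
  refine forall_congr' fun K => forall_congr' fun _ => forall_congr' fun _ => forall_congr' fun _ => ?_
  exact exists_rule_iff_forall_stateWins q

/-- **`TerminatesSomeRule p q` ⟺ no field of characteristic `p` carries a nonempty trap.**
[OURS · frame bookkeeping] [folklore] -/
theorem terminatesSomeRule_iff_not_exists_trap (p q : ℕ) :
    TerminatesSomeRule p q ↔
      ∀ (K : Type) [Field K] [CharP K p] [DecidableEq K],
        ¬ ∃ T : Set (State K), IsTrap q T ∧ T.Nonempty := by
  rw [terminatesSomeRule_iff_forall_stateWins]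
  refine forall_congr' fun K => forall_congr' fun _ => forall_congr' fun _ => forall_congr' fun _ => ?_
  exact forall_stateWins_iff_not_exists_trap q

/-- **Completeness of the kill certificate** (converse of `not_terminatesSomeRule_of_trap`):
`TerminatesSomeRule p q` FAILS iff SOME field of characteristic `p` (with decidable equality) carries a
nonempty `IsTrap` set. [OURS · frame bookkeeping] [folklore] -/
theorem not_terminatesSomeRule_iff_exists_trap (p q : ℕ) :
    ¬ TerminatesSomeRule p q ↔
      ∃ (K : Type) (_ : Field K) (_ : CharP K p) (_ : DecidableEq K) (T : Set (State K)),
        IsTrap q T ∧ T.Nonempty := by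
  rw [terminatesSomeRule_iff_not_exists_trap]
  constructor
  · intro h
    by_contra hne
    apply h
    intro K _ _ _ hT
    exact hne ⟨K, ‹_›, ‹_›, ‹_›, hT⟩
  · rintro ⟨K, _, _, _, T, hT, hne⟩ h
    exact h K ⟨T, hT, hne⟩

end Summit.ResolutionOfSingularities.ResolutionOfSingularities.Theorems.PIDim4
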